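import Summits.QuantumFields.YangMills.Theses.RecentredCoverTransfer
import Summits.QuantumFields.YangMills.Theorems.RecentredCoverTransferCellPartialMoments
import Summits.QuantumFields.YangMills.Theorems.RecentredCoverTransferRecentringExpansion
import Summits.QuantumFields.YangMills.Theorems.LangevinControlUVOSLegsFromFemtoAndGapStubAssemblyShiftedBound
import HarnessLib

/-!
# Route `RecentredCoverTransfer` (LINE g9-C of planner ym-idea-1 g9), glue item `CoverRecentringOfRate` (stmt-QuantumFields-23144)

`OnePointRate → CoverMomentBounds6 → CoverRecentring`.

Fix the binders of `CoverRecentring` (`n ≥ 2`, `F` off-diagonal with compact support) and write `δ_k = m_C(k) − m_T(k)`,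
`W^S_k(x) = ∫ ∏_{i∈S} (d(τ_{xᵢ}Ũ) − m_C(k)) dμ_{C_k}` for `S ⊆ [n]`.

1. **Expansion** (`Theorems/RecentredCoverTransferRecentringExpansion`, `dist_sub_dist_eq_sum_ssubsets`):
   `dist_{C_k}(m_T) F − dist_{C_k}(m_C) F = Σ_{S ⊊ [n]} δ_k^(n−|S|) · Σ_{x ∈ repsⁿ} W^S_k(x) F(a_k x)`; the sum over `S` is over a
   FIXED finite set, so it suffices that every `S`-term tends to `0` (`tendsto_finsetSum`).
2. **One lattice, one proper `S`** (`norm_properTerm_le`): for `0 < a ≤ 1`, `a ≤ ℓ₄`, `14 ≤ L`, `a⁻² ≤ L`, `box L ⊆ reps`, a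
   `CoverMomentBounds6`-type ceiling for the strings of the cell and the support condition «`F(a x) = 0` unless `x ⊆ box(L/2)`»:
   `‖δ^(n−|S|) Σ_{x∈repsⁿ} W^S(x) F(a x)‖ ≤ (a⁻⁴|δ|)^(n−|S|) · Kⁿ · Σ(F)`.  PROOF: the sum over `repsⁿ` equals the sum over
   `box(L)ⁿ` of `W^S·1[x ⊆ box(L/2)]` (support); the weight `V(x) = (a⁴)^(n−|S|) W^S(x) 1[x ⊆ box(L/2)]` has the sup bound
   `(2B+1)ⁿ` (`abs_partialMoment_le_pow`) and the collar bound `((6C₀ + ℓ₄⁴)/R⁴)ⁿ` at torus-separated sites (inside `box(L/2)` torus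
   separation is plain separation, `valMinAbs_intCast_of_abs_le`; `abs_partialMoment_le_of_strings`; `a⁴ ≤ ℓ₄⁴/R⁴`), so the tree's
   ABSTRACT-WEIGHTS bound `OSLegsFromFemtoAndGap.norm_sum_weight_mul_le` (flat decay of `F ∈ ⁰𝒮` near the diagonal — NOT a
   positive distance of `supp F` from the diagonal, which `IsOffDiagonal` does not give) bounds `‖Σ_{box(L)ⁿ} V F(a·)‖ ≤ Kⁿ Σ(F)`.
3. **Limit** (`coverRecentring_of_rate`): along a leg scheme `a_k ≤ 1/24`, `14 ≤ L_k`, `a_k⁻² ≤ L_k` always, `a_k ≤ ℓ₄` and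
   `β_k ≥ β₄` eventually, and `a_k L_k → ∞` makes the support condition eventual (`eventually_apply_eq_zero_of_not_mem_box`);
   `OnePointRate` gives `a_k⁻⁴|δ_k| → 0`, hence every proper `S`-term → 0 (`n − |S| ≥ 1`).

Width seat ym-line-sfw-p2-w3 g28 (cell ym-idea-1; free hands).  THEOREMS ONLY.  HONEST FRAMING: the children `OnePointRate` (23142, the
one scalar: energy-density finite-size insensitivity at physical precision) and `CoverMomentBounds6` (23143, Bałaban ceilings on the
checkerboard cells) are OPEN (XL / L); this glue proves no crux, no rung (R2d ROT is a RECORD rung), no summit; the Yang–Mills mass gap is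
NOT proved by any of this.
-/

set_option autoImplicit false

noncomputable section

open scoped SchwartzMap BigOperators ENNReal
open MeasureTheory Filter Topology
open Literature.MathematicalPhysics.QuantumFieldTheory Literature.MathematicalPhysics.QuantumLattice
open Literature.MathematicalPhysics.AQFT
open Literature.Probability.LatticeModels (Site box mem_box)
open Summit.QuantumFields.YangMills.Theorems.ROT (PeriodCell)
open Summit.QuantumFields.YangMills.Theorems.OSLegsFromFemtoAndGap (norm_sum_weight_mul_le valMinAbs_intCast_of_abs_le
  mul_norm_le_norm_smul_siteToE)
open Summit.QuantumFields.YangMills.Theorems.InfiniteVolume (stateMomentStr)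

namespace Summit.QuantumFields.YangMills.Theorems.RecentredCoverTransfer

variable {G : Type} [Group G] [TopologicalSpace G] [IsTopologicalGroup G] [CompactSpace G]
  [MeasurableSpace G] [BorelSpace G]

/-! ## §1 Boxes -/

omit [Group G] [TopologicalSpace G] [IsTopologicalGroup G] [CompactSpace G] [MeasurableSpace G] [BorelSpace G] in
/-- `box (L/2) ⊆ box L`. [folklore] -/
theorem box_half_subset (L : ℕ) : box 4 (L / 2) ⊆ box 4 L := fun z hz => by
  rw [mem_box] at hz ⊢
  intro i
  have h := hz i
  constructor <;> omega

omit [Group G] [TopologicalSpace G] [IsTopologicalGroup G] [CompactSpace G] [MeasurableSpace G] [BorelSpace G] in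
/-- Inside `box(L/2)` the torus separation of `ℤ/(2L+1)` is the plain separation. [folklore] -/
theorem valMinAbs_sub_eq_of_mem_box_half {L : ℕ} {z w : Site 4} (hz : z ∈ box 4 (L / 2)) (hw : w ∈ box 4 (L / 2)) (k : Fin 4) :
    ((((z k - w k : ℤ) : ZMod (2 * L + 1))).valMinAbs : ℤ) = z k - w k := by
  refine valMinAbs_intCast_of_abs_le (abs_le.2 ⟨?_, ?_⟩)
  · have h1 := (mem_box.1 hz k).1; have h2 := (mem_box.1 hw k).2; omega
  · have h1 := (mem_box.1 hz k).2; have h2 := (mem_box.1 hw k).1; omega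

/-! ## §2 One lattice, one proper subset: the bound through the abstract-weights lemma -/

/-- **The proper `S`-term at one lattice.**  See the module docstring, step 2. [folklore] -/
theorem norm_properTerm_le (Ce : PeriodCell 4) (r : LatticeRep G) (β : ℝ) {C₀ ℓ₄ B a : ℝ} {L n : ℕ}
    (hℓ : 0 < ℓ₄) (hC₀ : 0 ≤ C₀) (hB : ∀ V, |r.curvature.F V| ≤ B)
    (ha : 0 < a) (ha1 : a ≤ 1) (haℓ : a ≤ ℓ₄) (hL14 : 14 ≤ L) (hLa : a⁻¹ * a⁻¹ ≤ L) (hn : 2 ≤ n)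
    (hreps : box 4 L ⊆ Ce.reps)
    (H : ∀ (m : ℕ) (q : Fin m → Fin 4 × Fin 4) (y : Fin m → Site 4) (R : ℕ), (∀ j, (q j).1 < (q j).2) → 1 ≤ R →
      (R : ℝ) * a ≤ ℓ₄ → 4 * R + 8 ≤ L → (∀ j, y j ∈ box 4 (L / 2)) →
      (∀ j j' : Fin m, j ≠ j' → ∃ k : Fin 4, (2 * (R : ℤ) + 4) ≤ |y j k - y j' k|) →
      |stateMomentStr G r (Measure.map Ce.lift (Ce.measure r.ρ β)) m q y| ≤ (C₀ / (R : ℝ) ^ 4) ^ m)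
    (F : 𝓢((Fin n → EuclideanSpace ℝ (Fin 4)), ℂ)) (hF : IsOffDiagonal F)
    (hsupp : ∀ x : Fin n → Site 4, (∃ i, x i ∉ box 4 (L / 2)) → F (fun i => a • siteToE (x i)) = 0)
    (S : Finset (Fin n)) (hS : S.card ≤ n) (m : ℝ) :
    ‖(((Ce.mean r.ρ β r.curvature.F - m) ^ (n - S.card) : ℝ) : ℂ) *
        ∑ x ∈ Fintype.piFinset (fun _ : Fin n => Ce.reps),
          ((∫ U, ∏ i ∈ S, (r.curvature.F (configShift (-(x i)) (Ce.lift U)) - Ce.mean r.ρ β r.curvature.F)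
              ∂(Ce.measure r.ρ β) : ℝ) : ℂ) * F (fun i => a • siteToE (x i))‖ ≤
      (a⁻¹ ^ 4 * |Ce.mean r.ρ β r.curvature.F - m|) ^ (n - S.card) *
        ((((2 * B + 1) * 4 ^ 4 * 5 ^ 6 + (2 * B + 1) * 2 ^ 6 * (10 + 2 * 0) ^ 4 +
            16 * (6 * C₀ + ℓ₄ ^ 4) * 2 ^ 6 * (2 / ℓ₄ + 48) ^ 4) * 2 ^ 6 * (81 * ∑' m : ℕ, (((m : ℝ) + 1) ^ 2)⁻¹)) ^ n *
          (SchwartzMap.seminorm ℂ 0 (4 * n) F + SchwartzMap.seminorm ℂ (6 * n) (4 * n) F +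
            SchwartzMap.seminorm ℂ 0 0 F + SchwartzMap.seminorm ℂ (6 * n) 0 F + SchwartzMap.seminorm ℂ (10 * n) 0 F)) := by
  classical
  -- abbreviations
  set μC := Ce.mean r.ρ β r.curvature.F with hμC
  set δ : ℝ := μC - m with hδ
  set W : (Fin n → Site 4) → ℝ := fun x =>
    ∫ U, ∏ i ∈ S, (r.curvature.F (configShift (-(x i)) (Ce.lift U)) - μC) ∂(Ce.measure r.ρ β) with hW
  set V : (Fin n → Site 4) → ℝ := fun x =>
    (a ^ 4) ^ (n - S.card) * W x * (if x ∈ Fintype.piFinset (fun _ : Fin n => box 4 (L / 2)) then 1 else 0) with hV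
  have hB0 : 0 ≤ B := (abs_nonneg _).trans (hB 1)
  have ha4 : 0 < a ^ 4 := by positivity
  have ha41 : a ^ 4 ≤ 1 := pow_le_one₀ ha.le ha1
  -- (i) support: both sums are the sum over `box(L/2)ⁿ`
  have hsub1 : Fintype.piFinset (fun _ : Fin n => box 4 (L / 2)) ⊆ Fintype.piFinset (fun _ : Fin n => Ce.reps) :=
    Fintype.piFinset_subset _ _ fun _ => (box_half_subset L).trans hreps
  have hsub2 : Fintype.piFinset (fun _ : Fin n => box 4 (L / 2)) ⊆ Fintype.piFinset (fun _ : Fin n => box 4 L) :=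
    Fintype.piFinset_subset _ _ fun _ => box_half_subset L
  have hout : ∀ x : Fin n → Site 4, x ∉ Fintype.piFinset (fun _ : Fin n => box 4 (L / 2)) →
      F (fun i => a • siteToE (x i)) = 0 := fun x hx => by
    refine hsupp x ?_
    by_contra h
    push Not at h
    exact hx (Fintype.mem_piFinset.2 h)
  have hsumW : ∑ x ∈ Fintype.piFinset (fun _ : Fin n => Ce.reps), ((W x : ℝ) : ℂ) * F (fun i => a • siteToE (x i)) =
      ∑ x ∈ Fintype.piFinset (fun _ : Fin n => box 4 (L / 2)), ((W x : ℝ) : ℂ) * F (fun i => a • siteToE (x i)) :=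
    (Finset.sum_subset hsub1 fun x _ hx => by rw [hout x hx, mul_zero]).symm
  have hsumV : ∑ x ∈ Fintype.piFinset (fun _ : Fin n => box 4 L), ((V x : ℝ) : ℂ) * F (fun i => a • siteToE (x i)) =
      ∑ x ∈ Fintype.piFinset (fun _ : Fin n => box 4 (L / 2)),
        (((a ^ 4) ^ (n - S.card) : ℝ) : ℂ) * (((W x : ℝ) : ℂ) * F (fun i => a • siteToE (x i))) := by
    rw [← Finset.sum_subset hsub2 fun x _ hx => by rw [hout x hx, mul_zero]]
    refine Finset.sum_congr rfl fun x hx => ?_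
    simp only [hV, hx, if_true, mul_one, Complex.ofReal_mul]
    ring
  -- (ii) pull out `(a⁴)^(n−|S|)`
  have hkey : (((δ ^ (n - S.card) : ℝ)) : ℂ) *
      ∑ x ∈ Fintype.piFinset (fun _ : Fin n => Ce.reps), ((W x : ℝ) : ℂ) * F (fun i => a • siteToE (x i)) =
      ((((a⁻¹ ^ 4 * δ) ^ (n - S.card) : ℝ)) : ℂ) *
        ∑ x ∈ Fintype.piFinset (fun _ : Fin n => box 4 L), ((V x : ℝ) : ℂ) * F (fun i => a • siteToE (x i)) := by
    have hreal : (a⁻¹ ^ 4 * δ) ^ (n - S.card) * (a ^ 4) ^ (n - S.card) = δ ^ (n - S.card) := by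
      have h1 : a ^ 4 * a⁻¹ ^ 4 = 1 := by rw [← mul_pow, mul_inv_cancel₀ ha.ne', one_pow]
      calc (a⁻¹ ^ 4 * δ) ^ (n - S.card) * (a ^ 4) ^ (n - S.card)
          = (a ^ 4 * a⁻¹ ^ 4) ^ (n - S.card) * δ ^ (n - S.card) := by ring
        _ = δ ^ (n - S.card) := by rw [h1, one_pow, one_mul]
    rw [hsumW, hsumV, ← Finset.mul_sum, ← mul_assoc, ← Complex.ofReal_mul, hreal]
  -- (iii) the abstract-weights lemma
  have hM : (0 : ℝ) ≤ 2 * B + 1 := by positivity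
  have hCw : (0 : ℝ) ≤ 6 * C₀ + ℓ₄ ^ 4 := by positivity
  have hWabs : ∀ x, |W x| ≤ (2 * B) ^ S.card := fun x => abs_partialMoment_le_pow Ce r β hB S x
  have hVsup : ∀ x, |V x| ≤ (2 * B + 1) ^ n := fun x => by
    have h1 : |V x| ≤ |W x| := by
      simp only [hV]
      split_ifs
      · rw [mul_one, abs_mul, abs_of_pos (pow_pos ha4 _)]
        exact mul_le_of_le_one_left (abs_nonneg _) (pow_le_one₀ ha4.le ha41)
      · rw [mul_zero, abs_zero]; exact abs_nonneg _
    refine h1.trans ((hWabs x).trans ?_)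
    calc (2 * B) ^ S.card ≤ (2 * B + 1) ^ S.card := pow_le_pow_left₀ (by positivity) (by linarith) _
      _ ≤ (2 * B + 1) ^ n := pow_le_pow_right₀ (by linarith) hS
  have hVcol : ∀ (x : Fin n → Site 4) (R : ℕ), 1 ≤ R → (R : ℝ) * a ≤ ℓ₄ → 4 * R + 8 ≤ L →
      (∀ i j : Fin n, i ≠ j → ∃ k : Fin 4,
        (2 * (R : ℤ) + 4) ≤ |((((x i k - x j k : ℤ) : ZMod (2 * L + 1))).valMinAbs : ℤ)|) →
      |V x| ≤ ((6 * C₀ + ℓ₄ ^ 4) / (R : ℝ) ^ 4) ^ n := by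
    intro x R hR hRa hRL hsep
    have hR0 : (0 : ℝ) < R := by exact_mod_cast hR
    by_cases hx : x ∈ Fintype.piFinset (fun _ : Fin n => box 4 (L / 2))
    · have hxb : ∀ i, x i ∈ box 4 (L / 2) := Fintype.mem_piFinset.1 hx
      -- plain separation inside `box(L/2)`
      have hsep' : ∀ i ∈ S, ∀ i' ∈ S, i ≠ i' → ∃ k : Fin 4, (2 * (R : ℤ) + 4) ≤ |x i k - x i' k| := by
        intro i _ i' _ hii'
        obtain ⟨k, hk⟩ := hsep i i' hii'
        exact ⟨k, by rwa [valMinAbs_sub_eq_of_mem_box_half (hxb i) (hxb i') k] at hk⟩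
      have hWcol : |W x| ≤ (6 * C₀ / (R : ℝ) ^ 4) ^ S.card :=
        abs_partialMoment_le_of_strings Ce r β (fun m' q y hq hy hs => H m' q y R hq hR hRa hRL hy hs) S x
          (fun i _ => hxb i) hsep'
      -- `a⁴ ≤ ℓ₄⁴/R⁴`
      have ha4R : a ^ 4 ≤ ℓ₄ ^ 4 / (R : ℝ) ^ 4 := by
        rw [le_div_iff₀ (by positivity), ← mul_pow]
        exact pow_le_pow_left₀ (by positivity) (by nlinarith) 4
      have hq1 : ℓ₄ ^ 4 / (R : ℝ) ^ 4 ≤ (6 * C₀ + ℓ₄ ^ 4) / (R : ℝ) ^ 4 :=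
        div_le_div_of_nonneg_right (by linarith [mul_nonneg (by norm_num : (0:ℝ) ≤ 6) hC₀]) (by positivity)
      have hq2 : 6 * C₀ / (R : ℝ) ^ 4 ≤ (6 * C₀ + ℓ₄ ^ 4) / (R : ℝ) ^ 4 :=
        div_le_div_of_nonneg_right (by linarith [pow_nonneg hℓ.le 4]) (by positivity)
      simp only [hV, hx, if_true, mul_one]
      rw [abs_mul, abs_of_pos (pow_pos ha4 _)]
      calc (a ^ 4) ^ (n - S.card) * |W x|
          ≤ ((6 * C₀ + ℓ₄ ^ 4) / (R : ℝ) ^ 4) ^ (n - S.card) * ((6 * C₀ + ℓ₄ ^ 4) / (R : ℝ) ^ 4) ^ S.card :=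
            mul_le_mul (pow_le_pow_left₀ ha4.le (ha4R.trans hq1) _)
              (hWcol.trans (pow_le_pow_left₀ (by positivity) hq2 _)) (abs_nonneg _) (by positivity)
        _ = ((6 * C₀ + ℓ₄ ^ 4) / (R : ℝ) ^ 4) ^ n := by rw [← pow_add, Nat.sub_add_cancel hS]
    · simp only [hV, hx, if_false, mul_zero, abs_zero]
      positivity
  have hAbs := norm_sum_weight_mul_le (L := L) (n := n) (s := 0) hℓ hCw hM V hVsup hVcol ha ha1 haℓ hL14 hLa hn le_rfl
    (by norm_num) (by rw [zero_mul]; norm_num) F hF (fun x => fun l => a • siteToE (x l))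
    (fun x l => by rw [sub_self, norm_zero, zero_mul])
  -- (iv) combine
  rw [hkey, norm_mul, Complex.norm_real, Real.norm_eq_abs, abs_pow, abs_mul, abs_of_pos (pow_pos (inv_pos.2 ha) 4)]
  exact mul_le_mul_of_nonneg_left hAbs (by positivity)

/-! ## §3 The support condition is eventual along a scheme -/

omit [Group G] [TopologicalSpace G] [IsTopologicalGroup G] [CompactSpace G] [MeasurableSpace G] [BorelSpace G] in
/-- **Compact support vs. growing physical size**: along any scheme (`a_k L_k → ∞`), for `k` large a compactly supported `F` vanishes at
`a_k·x` as soon as one point `xᵢ` leaves `box(L_k/2)` (then `‖a_k xᵢ‖ > a_k L_k/2 → ∞`). [folklore] -/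
theorem eventually_apply_eq_zero_of_not_mem_box {ι : Type} (sch : SpeciesScheme ι) {n : ℕ}
    (F : 𝓢((Fin n → EuclideanSpace ℝ (Fin 4)), ℂ)) (hFc : HasCompactSupport (F : (Fin n → EuclideanSpace ℝ (Fin 4)) → ℂ)) :
    ∀ᶠ k in atTop, ∀ x : Fin n → Site 4, (∃ i, x i ∉ box 4 (sch.L k / 2)) → F (fun i => sch.a k • siteToE (x i)) = 0 := by
  obtain ⟨R, hR⟩ := (Metric.isBounded_iff_subset_closedBall (0 : Fin n → EuclideanSpace ℝ (Fin 4))).1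
    hFc.isCompact.isBounded
  filter_upwards [sch.tendsto_L.eventually_gt_atTop (2 * R + 1)] with k hk x hx
  obtain ⟨i, hi⟩ := hx
  apply image_eq_zero_of_notMem_tsupport
  intro hmem
  have hball := hR hmem
  rw [Metric.mem_closedBall, dist_zero_right] at hball
  rw [mem_box, not_forall] at hi
  obtain ⟨j, hj⟩ := hi
  set L2 : ℕ := sch.L k / 2 with hL2def
  have hjz : (L2 : ℤ) + 1 ≤ |x i j| := by
    rw [not_and_or, not_le, not_le] at hj
    rcases hj with h | h
    · rw [abs_of_neg (by omega)]; omega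
    · rw [abs_of_pos (by omega)]; omega
  have hxij : (L2 : ℝ) + 1 ≤ |((x i j : ℤ) : ℝ)| := by
    have h' : (((L2 : ℤ) + 1 : ℤ) : ℝ) ≤ ((|x i j| : ℤ) : ℝ) := by exact_mod_cast hjz
    simpa [Int.cast_abs] using h'
  have ha := sch.a_pos k
  have hnorm : sch.a k * ((L2 : ℝ) + 1) ≤ ‖fun i => sch.a k • siteToE (x i)‖ :=
    calc sch.a k * ((L2 : ℝ) + 1) ≤ sch.a k * |((x i j : ℤ) : ℝ)| := mul_le_mul_of_nonneg_left hxij ha.le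
      _ ≤ sch.a k * ‖x i‖ := by
          refine mul_le_mul_of_nonneg_left ?_ ha.le
          have h := norm_le_pi_norm (x i) j
          rwa [Int.norm_eq_abs] at h
      _ ≤ ‖sch.a k • siteToE (x i)‖ := mul_norm_le_norm_smul_siteToE ha.le (x i)
      _ ≤ ‖fun i => sch.a k • siteToE (x i)‖ := norm_le_pi_norm (fun i => sch.a k • siteToE (x i)) i
  have hL2 : (sch.L k : ℝ) ≤ 2 * ((L2 : ℝ) + 1) := by
    have h : sch.L k ≤ 2 * (L2 + 1) := by omega
    exact_mod_cast h
  have h1 : sch.a k * sch.L k ≤ 2 * (sch.a k * ((L2 : ℝ) + 1)) := by nlinarith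
  linarith

/-! ## §4 The limit: `OnePointRate → CoverMomentBounds6 → CoverRecentring` -/

/-- **LINE g9-C glue**: the one scalar (`OnePointRate`) and the UV ceilings on the cover (`CoverMomentBounds6`) give
`CoverRecentring` — expansion over proper subsets, each term `≤ (a_k⁻⁴|δ_k|)^(n−|S|)·Kⁿ·Σ(F) → 0`. [folklore] -/
theorem coverRecentring_of_rate
    (h1 : Summit.QuantumFields.YangMills.Theses.RecentredCoverTransfer.OnePointRate)
    (h6 : Summit.QuantumFields.YangMills.Theses.RecentredCoverTransfer.CoverMomentBounds6) :
    Summit.QuantumFields.YangMills.Theses.RecentredCoverTransfer.CoverRecentring := by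
  intro G _ _ _ _ hG
  letI : MeasurableSpace G := borel G
  haveI : BorelSpace G := ⟨rfl⟩
  intro r a ha ha0 hMB sch hsch C hC n hn F hF hFc
  have hΔ := h1 G hG r a ha ha0 hMB sch hsch C hC
  obtain ⟨C₀, β₄, ℓ₄, hℓ, hC₀, H6⟩ := h6 G hG r a ha ha0 hMB
  obtain ⟨B, hB⟩ := r.curvature.bounded
  obtain ⟨hsa, hβ, hk⟩ := hsch
  -- `ε_k = a_k⁻⁴ |m_C − m_T| → 0`
  have hε : Tendsto (fun k => (sch.a k)⁻¹ ^ 4 *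
      |(C k).mean r.ρ (sch.β k) r.curvature.F - wilsonTorusMean r.ρ (sch.β k) (sch.L k) r.curvature.F|) atTop (𝓝 0) := by
    have h := hΔ.norm
    rw [norm_zero] at h
    refine h.congr fun k => ?_
    rw [Real.norm_eq_abs, abs_mul, abs_of_pos (pow_pos (inv_pos.2 (sch.a_pos k)) 4), abs_sub_comm]
  -- eventual conditions along the scheme
  have hEℓ : ∀ᶠ k in atTop, sch.a k ≤ ℓ₄ := ((tendsto_order.1 sch.tendsto_a).2 ℓ₄ hℓ).mono fun k hk => hk.le
  have hEβ : ∀ᶠ k in atTop, β₄ ≤ sch.β k := hβ.eventually_ge_atTop β₄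
  have hEsupp := eventually_apply_eq_zero_of_not_mem_box sch F hFc
  -- every proper-subset term tends to `0`
  have hterm : ∀ S ∈ ((Finset.univ : Finset (Fin n)).powerset).erase Finset.univ,
      Tendsto (fun k => ((((C k).mean r.ρ (sch.β k) r.curvature.F -
          wilsonTorusMean r.ρ (sch.β k) (sch.L k) r.curvature.F) ^ (n - S.card) : ℝ) : ℂ) *
        ∑ x ∈ Fintype.piFinset (fun _ : Fin n => (C k).reps),
          ((∫ U, ∏ i ∈ S, (r.curvature.F (configShift (-(x i)) ((C k).lift U)) - (C k).mean r.ρ (sch.β k) r.curvature.F)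
              ∂((C k).measure r.ρ (sch.β k)) : ℝ) : ℂ) * F (fun i => sch.a k • siteToE (x i))) atTop (𝓝 0) := by
    intro S hS
    have hSn : S.card ≤ n := by simpa using Finset.card_le_univ S
    have hpos : 1 ≤ n - S.card := one_le_sub_card_of_mem_erase hS
    obtain ⟨K, hK⟩ : ∃ K : ℝ, ∀ᶠ k in atTop,
        ‖((((C k).mean r.ρ (sch.β k) r.curvature.F -
            wilsonTorusMean r.ρ (sch.β k) (sch.L k) r.curvature.F) ^ (n - S.card) : ℝ) : ℂ) *
          ∑ x ∈ Fintype.piFinset (fun _ : Fin n => (C k).reps),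
            ((∫ U, ∏ i ∈ S, (r.curvature.F (configShift (-(x i)) ((C k).lift U)) - (C k).mean r.ρ (sch.β k) r.curvature.F)
                ∂((C k).measure r.ρ (sch.β k)) : ℝ) : ℂ) * F (fun i => sch.a k • siteToE (x i))‖ ≤
          ((sch.a k)⁻¹ ^ 4 * |(C k).mean r.ρ (sch.β k) r.curvature.F -
            wilsonTorusMean r.ρ (sch.β k) (sch.L k) r.curvature.F|) ^ (n - S.card) * K := by
      refine ⟨?_, ?_⟩
      swap
      filter_upwards [hEℓ, hEβ, hEsupp] with k hkℓ hkβ hksupp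
      obtain ⟨-, hk24, hk14, hkL⟩ := hk k
      have hk1 : sch.a k ≤ 1 := hk24.trans (by norm_num)
      have H : ∀ (m : ℕ) (q : Fin m → Fin 4 × Fin 4) (y : Fin m → Site 4) (R : ℕ), (∀ j, (q j).1 < (q j).2) → 1 ≤ R →
          (R : ℝ) * sch.a k ≤ ℓ₄ → 4 * R + 8 ≤ sch.L k → (∀ j, y j ∈ box 4 (sch.L k / 2)) →
          (∀ j j' : Fin m, j ≠ j' → ∃ k' : Fin 4, (2 * (R : ℤ) + 4) ≤ |y j k' - y j' k'|) →
          |stateMomentStr G r (Measure.map (C k).lift ((C k).measure r.ρ (sch.β k))) m q y| ≤ (C₀ / (R : ℝ) ^ 4) ^ m :=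
        fun m q y R hq hR hRa hRL hy hs =>
          H6 (sch.β k) hkβ (C k) (sch.L k) (hC k) m q y R hq hR (by rw [← hsa k]; exact hRa) hRL hy hs
      exact norm_properTerm_le (C k) r (sch.β k) hℓ hC₀ hB (sch.a_pos k) hk1 hkℓ hk14 hkL hn (hC k).2 H F hF hksupp S hSn
        (wilsonTorusMean r.ρ (sch.β k) (sch.L k) r.curvature.F)
    refine squeeze_zero_norm' hK ?_
    have h := (hε.pow (n - S.card)).mul_const K
    rwa [zero_pow (by omega), zero_mul] at h
  -- assemble: the expansion over proper subsets
  have hsum := tendsto_finsetSum _ hterm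
  rw [Finset.sum_const_zero] at hsum
  have hneg := hsum.neg
  rw [neg_zero] at hneg
  refine hneg.congr fun k => ?_
  rw [← dist_sub_dist_eq_sum_ssubsets (C k) r.ρ r.continuous (sch.β k) (fun z => sch.a k • siteToE z)
    r.curvature.measurable hB (wilsonTorusMean r.ρ (sch.β k) (sch.L k) r.curvature.F)
    ((C k).mean r.ρ (sch.β k) r.curvature.F) n F, neg_sub]

/-- **Item stmt-QuantumFields-23144 `RecentredCoverTransfer.CoverRecentringOfRate` holds**:
`OnePointRate → CoverMomentBounds6 → CoverRecentring`. [folklore] -/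
theorem coverRecentringOfRate_proof :
    Summit.QuantumFields.YangMills.Theses.RecentredCoverTransfer.CoverRecentringOfRate :=
  fun h1 h6 => coverRecentring_of_rate h1 h6

end Summit.QuantumFields.YangMills.Theorems.RecentredCoverTransfer

end
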